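import Summits.HubbardSuperconductivity.HubbardSuperconductivity.Theorems.ThermalWedgeTwSeededEnsembleEquivalenceRFreeColdUniqCalibration
import Summits.HubbardSuperconductivity.HubbardSuperconductivity.Theorems.ThermalWedgeTwSeededEnsembleEquivalenceRFreeSourcedPressureFormula

/-!
# Crux `TwSeededEnsembleEquivalenceR` (stmt-HubbardSuperconductivity-15581), line `cold-floor-collapse`
# (slug `Sketch`, skeleton v8) — calibration `cal_freeConcavity`: CONC holds at the solvable corner `U = 0`

Support file (`--supports stmt-HubbardSuperconductivity-15581`; sorry-free; no definition; route-file free).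

The glue `nsc_noSplit_of_concavity` (…RNoSplitOfConcavity, G1) closes the cold slice of the crux from plain
concavity of the sourced limit pressure in the SQUARED source on the WHOLE box, `s ↦ q(μ,√s)` on `[0,(13g+1)²]`
(hypothesis CONC; no optimiser floor, no `TwSourcedCondensation`), and `nsc_concavity_of_finiteVolume` reduces
CONC to its finite-volume form FV-CONC. This file proves both forms at the solvable corner `U = 0`, for EVERY
inverse temperature `β > 0`, every `μ` and every torus side `L ≥ 3` — the statement the docstring of G1 calls
"true and elementary at `U = 0`":

* `cal_freeConcavity_finiteVolume` — FV-CONC at `U = 0`, exactly (no `L₀`): for `L ≥ 3` the free sourced torus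
  log-partition function is the mode sum `2L² log 2 + Σ_k [−βξ_k + log((1 + cosh βE_k)/2)]`,
  `E_k² = ξ_k² + 8s·(cos k₁ − cos k₂)²` (`twR_log_partitionFn_free_eq`), and each mode is concave in `s ≥ 0`
  (`cuq_modeG_strictConcaveOn`: `d/ds` of the mode is `(wβ/4)·tanh(βE/2)/(βE/2)`, decreasing in `E`);
* `cal_freeConcavity` — CONC at `U = 0` in the quantifier shape of the G1 hypothesis (binder for binder, with
  `dWaveSourceTorus L U μ h`, `β = e^{a/U}` replaced by `dWaveSourceTorus L 0 μ h`, any `β > 0`): every pointwise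
  thermodynamic limit `q` of the free sourced pressure on `[μ₁,μ₂] × [−(13g+1), 13g+1]` has `s ↦ q μ √s` concave on
  `[0,(13g+1)²]` (pointwise limits of concave functions are concave).

So the physics left in CONC is the `O(U)` (relative) control of the second `s`-derivative of the interacting
sourced pressure, uniformly down to `s = 0` at `β = e^{a/U}`; at `U = 0` there is no floor and no smallness of `β`.
[folklore: concavity of the BCS/BdG functional in the squared gap]
-/

set_option linter.dupNamespace false

namespace Summit.HubbardSuperconductivity.HubbardSuperconductivity.Theorems.TwSeededEnsembleEquivalenceR.ColdFloorLine

open Real Set Literature.MathematicalPhysics.QuantumLattice Literature.Probability.LatticeModels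

/-! ### Concavity bookkeeping -/

/-- A finite sum of functions concave on `S` is concave on `S`. [folklore] -/
theorem cfc_concaveOn_finset_sum {ι : Type*} (t : Finset ι) {S : Set ℝ} (hS : Convex ℝ S)
    (f : ι → ℝ → ℝ) (hf : ∀ i ∈ t, ConcaveOn ℝ S (f i)) :
    ConcaveOn ℝ S (fun x => ∑ i ∈ t, f i x) := by
  classical
  induction t using Finset.induction_on with
  | empty => simpa using concaveOn_const (0 : ℝ) hS
  | insert a t ha ih =>
    have h1 : ConcaveOn ℝ S (f a) := hf a (Finset.mem_insert_self a t)
    have h2 : ConcaveOn ℝ S (fun x => ∑ i ∈ t, f i x) :=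
      ih fun i hi => hf i (Finset.mem_insert_of_mem hi)
    refine (h1.add h2).congr ?_
    intro x _
    simp [Finset.sum_insert ha]

/-- **One BdG mode is concave in the squared source.** For `β > 0` and any `ξ`, `d`,
`s ↦ log((1 + cosh(β√(ξ² + (2√2·√s·d)²)))/2)` is concave on `[0,∞)`: for `d ≠ 0` this is `β` times the strictly
concave mode `G` of `cuq_modeG_strictConcaveOn` (with `w = 8d²`, `(2√2·√s·d)² = s·8d²` on `s ≥ 0`); for `d = 0`
it is constant. [folklore] -/
theorem cfc_mode_concaveOn (β ξ d : ℝ) (hβ : 0 < β) :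
    ConcaveOn ℝ (Ici (0 : ℝ)) (fun s : ℝ =>
      Real.log ((1 + Real.cosh (β * Real.sqrt (ξ ^ 2 + (2 * Real.sqrt 2 * Real.sqrt s * d) ^ 2))) / 2)) := by
  have key : ConcaveOn ℝ (Ici (0 : ℝ)) (fun s : ℝ =>
      Real.log ((1 + Real.cosh (β * Real.sqrt (ξ ^ 2 + s * (8 * d ^ 2)))) / 2)) := by
    rcases (sq_nonneg d).eq_or_lt with hd | hd
    · refine (concaveOn_const (Real.log ((1 + Real.cosh (β * Real.sqrt (ξ ^ 2))) / 2))
        (convex_Ici 0)).congr ?_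
      intro s _
      simp only [← hd, mul_zero, add_zero]
    · have hw : 0 < 8 * d ^ 2 := by positivity
      have h := (cuq_modeG_strictConcaveOn (β := β) (w := 8 * d ^ 2) ξ hβ hw).concaveOn.smul hβ.le
      refine h.congr ?_
      intro s _
      simp only [smul_eq_mul]
      rw [← mul_assoc, mul_one_div_cancel hβ.ne', one_mul]
  refine key.congr ?_
  intro s hs
  simp only [cuq_gap_sq (Set.mem_Ici.1 hs)]

/-! ### FV-CONC at `U = 0` -/

/-- **FV-CONC at the solvable corner `U = 0` (exact, every `β > 0`, `μ`, `L ≥ 3`).** The finite-volume free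
d-wave-sourced torus pressure `s ↦ log Re Z_β(dWaveSourceTorus L 0 μ √s)/(βL²)` is concave on `[0,∞)` in the
squared source `s = h²`: by `twR_log_partitionFn_free_eq` it is `(βL²)⁻¹·[2L² log 2 + Σ_k (−βξ_k + mode_k(s))]`
with every `mode_k` concave (`cfc_mode_concaveOn`). This is the hypothesis FV-CONC of `nsc_concavity_of_finiteVolume`
at `U = 0`, with no `L₀` and no restriction on `β`. [folklore: BdG functional concave in the squared gap] -/
theorem cal_freeConcavity_finiteVolume (β μ : ℝ) (hβ : 0 < β) (L : ℕ) [NeZero L] (hL : 3 ≤ L) :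
    ConcaveOn ℝ (Ici (0 : ℝ)) (fun s : ℝ =>
      Real.log (Matrix.partitionFn β (dWaveSourceTorus L 0 μ (Real.sqrt s))).re / (β * (L : ℝ) ^ 2)) := by
  have hsum : ConcaveOn ℝ (Ici (0 : ℝ)) (fun s : ℝ =>
      ((2 * L ^ 2 : ℕ) : ℝ) * Real.log 2 +
        ∑ k : TorusSite 2 L, (-(β * (torusBand L k - μ)) +
          Real.log ((1 + Real.cosh (β * Real.sqrt ((torusBand L k - μ) ^ 2 +
            (2 * Real.sqrt 2 * Real.sqrt s * dWaveGap k) ^ 2))) / 2))) := by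
    refine (concaveOn_const _ (convex_Ici 0)).add
      (cfc_concaveOn_finset_sum _ (convex_Ici 0) _ fun k _ => ?_)
    exact (concaveOn_const _ (convex_Ici 0)).add (cfc_mode_concaveOn β _ _ hβ)
  have hc : (0 : ℝ) ≤ 1 / (β * (L : ℝ) ^ 2) := by positivity
  refine (hsum.smul hc).congr ?_
  intro s _
  simp only [smul_eq_mul]
  rw [twR_log_partitionFn_free_eq hL β μ (Real.sqrt s)]
  ring

/-! ### CONC at `U = 0` (the calibration, G1 shape) -/

/-- **Calibration of CONC at `U = 0`** (the hypothesis of `nsc_noSplit_of_concavity`, binder for binder, at the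
solvable corner: `dWaveSourceTorus L 0 μ h`, any `β > 0` in place of `e^{a/U}`). For `β > 0`, `g > 0`, any window
`[μ₁,μ₂]` and ANY function `q` that is a pointwise thermodynamic limit of the free sourced torus pressure on
`[μ₁,μ₂] × [−(13g+1), 13g+1]`, the map `s ↦ q μ √s` is concave on the whole squared box `[0,(13g+1)²]` for every
`μ ∈ [μ₁,μ₂]`: for `x, y, ax+by` in the box the finite-volume inequality of `cal_freeConcavity_finiteVolume`
passes to the limit along `L → ∞` (three pointwise limits, error `2κ`, `κ → 0`). No optimiser floor, no deep-source
restriction, no smallness of the temperature. [folklore] -/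
theorem cal_freeConcavity : ∀ (β : ℝ), 0 < β → ∀ (μ₁ μ₂ g : ℝ), 0 < g → ∀ q : ℝ → ℝ → ℝ,
    (∀ μ ∈ Set.Icc μ₁ μ₂, ∀ h ∈ Set.Icc (-(13 * g + 1)) (13 * g + 1), ∀ κ : ℝ, 0 < κ →
        ∃ L₀ : ℕ, ∀ (L : ℕ) [NeZero L], L₀ ≤ L →
          |Real.log (Matrix.partitionFn β (dWaveSourceTorus L 0 μ h)).re / (β * (L : ℝ) ^ 2) - q μ h| ≤ κ) →
    ∀ μ ∈ Set.Icc μ₁ μ₂,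
      ConcaveOn ℝ (Set.Icc 0 ((13 * g + 1) ^ 2)) (fun s : ℝ => q μ (Real.sqrt s)) := by
  intro β hβ μ₁ μ₂ g hg q hq μ hμ
  have hR : 0 < 13 * g + 1 := by positivity
  have hmem : ∀ s ∈ Set.Icc (0 : ℝ) ((13 * g + 1) ^ 2),
      Real.sqrt s ∈ Set.Icc (-(13 * g + 1)) (13 * g + 1) := by
    intro s hs
    refine ⟨by linarith [Real.sqrt_nonneg s], ?_⟩
    calc Real.sqrt s ≤ Real.sqrt ((13 * g + 1) ^ 2) := Real.sqrt_le_sqrt hs.2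
      _ = 13 * g + 1 := Real.sqrt_sq hR.le
  refine ⟨convex_Icc _ _, ?_⟩
  intro x hx y hy a b ha hb hab
  have hz : a • x + b • y ∈ Set.Icc (0 : ℝ) ((13 * g + 1) ^ 2) := (convex_Icc _ _) hx hy ha hb hab
  -- pass the finite-volume inequality to the limit
  refine le_of_forall_pos_le_add fun ε hε => ?_
  have hκ : 0 < ε / 2 := by positivity
  obtain ⟨L₁, hL₁⟩ := hq μ hμ (Real.sqrt x) (hmem x hx) (ε / 2) hκ
  obtain ⟨L₂, hL₂⟩ := hq μ hμ (Real.sqrt y) (hmem y hy) (ε / 2) hκ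
  obtain ⟨L₃, hL₃⟩ := hq μ hμ (Real.sqrt (a • x + b • y)) (hmem _ hz) (ε / 2) hκ
  set L : ℕ := max (max L₁ L₂) (max L₃ 3) with hLdef
  have hL3 : 3 ≤ L := le_trans (le_max_right _ _) (le_max_right _ _)
  haveI : NeZero L := ⟨by omega⟩
  have h1 := abs_le.1 (hL₁ L (le_trans (le_max_left _ _) (le_max_left _ _)))
  have h2 := abs_le.1 (hL₂ L (le_trans (le_max_right _ _) (le_max_left _ _)))
  have h3 := abs_le.1 (hL₃ L (le_trans (le_max_left _ _) (le_max_right _ _)))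
  have hfv := (cal_freeConcavity_finiteVolume β μ hβ L hL3).2 (Set.mem_Ici.2 hx.1) (Set.mem_Ici.2 hy.1)
    ha hb hab
  simp only [smul_eq_mul] at hfv h3 ⊢
  set fx := Real.log (Matrix.partitionFn β (dWaveSourceTorus L 0 μ (Real.sqrt x))).re / (β * (L : ℝ) ^ 2)
  set fy := Real.log (Matrix.partitionFn β (dWaveSourceTorus L 0 μ (Real.sqrt y))).re / (β * (L : ℝ) ^ 2)
  set fz := Real.log (Matrix.partitionFn β (dWaveSourceTorus L 0 μ (Real.sqrt (a * x + b * y)))).re /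
    (β * (L : ℝ) ^ 2)
  -- `a·q(√x) + b·q(√y) ≤ a(fx + κ) + b(fy + κ) = a fx + b fy + κ ≤ fz + κ ≤ q(√z) + 2κ`
  have ex : a * q μ (Real.sqrt x) ≤ a * (fx + ε / 2) := mul_le_mul_of_nonneg_left (by linarith) ha
  have ey : b * q μ (Real.sqrt y) ≤ b * (fy + ε / 2) := mul_le_mul_of_nonneg_left (by linarith) hb
  nlinarith
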